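import Mathlib
import HarnessLib
import Summits.NavierStokesRegularity.NavierStokesRegularity.Theorems.HalfSpaceWindowDoorCirculationCarryingRigidityDefs
import Summits.NavierStokesRegularity.NavierStokesRegularity.Theorems.HalfSpaceWindowDoorCirculationCarryingRigidityReduction
import Summits.NavierStokesRegularity.NavierStokesRegularity.Theorems.HalfSpaceWindowDoorCirculationCarryingRigidityGaussBlowdown
import Summits.NavierStokesRegularity.NavierStokesRegularity.Theorems.HalfSpaceWindowDoorCirculationCarryingRigidityGaussCirculation
import Summits.NavierStokesRegularity.NavierStokesRegularity.Theorems.HalfSpaceWindowDoorCirculationCarryingRigidityGaussSwirlLaw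
import Summits.NavierStokesRegularity.NavierStokesRegularity.Theorems.HalfSpaceWindowDoorCirculationCarryingRigidityHorizontalVorticityFloor
import Summits.NavierStokesRegularity.NavierStokesRegularity.Theorems.PoloidalWindowDoorPoloidalWindowRigidityWindow
import Summits.NavierStokesRegularity.NavierStokesRegularity.Theorems.SqueezeCycleExtremalElementExistsRescale
import Summits.NavierStokesRegularity.NavierStokesRegularity.Theorems.SqueezeCycleExtremalElementExistsExtraction

/-!
# Route `HalfSpaceWindowDoor`, crux `CirculationCarryingRigidity` (stmt-NavierStokesRegularity-25311) —
# the GAUSSIAN-EXTREMAL NORMAL FORM of the enemy of W6 (lines `extremal` × `gauss_swirl`)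

LEAD ns-hsw-p1 g7 (cell pub-ns-dss), `--supports stmt-NavierStokesRegularity-25311 --as helper`.  The research stub of the crux is W6
`HemisphereLiouvilleE3`.  Line `extremal` (LEAD g2, `…ExtremalProfile`) normalised the enemy by the POINTWISE scale-invariant
vertical vorticity `sup (−s)ω₃`; line `gauss_swirl` (ideator ns-idea-4, LEAD g6) found the exact law
`d𝒢/ds = −𝒢/(s₀−s) − ℐ/(2(s₀−s))` of the Gaussian axial angular momentum and left, as its §Next (a), a compactness / selection
statement for good axes.  This file runs the selection at the level of `𝒢` itself:

* `exists_gaussExtremal` — **GAUSSIAN-EXTREMAL NORMAL FORM.**  If a closed-hemisphere door-class profile with `ω₃ > 0` somewhere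
  exists (an enemy of W6, Type-I constant `C`), then there is a closed-hemisphere door-class profile `W` (same `C`) such that the
  scale-invariant Gaussian angular momentum `𝒢(−τ; y₀)[W(τ)]` (apex at the singular time, self-similar scale `√(−τ)`) attains its
  supremum over ALL `τ < 0`, `y₀ ∈ ℝ³` at `(τ, y₀) = (−1, 0)`, with value `Λ > 0`, AND the inflow correlation there is exactly
  `ℐ(1; 0)[W(−1)] = −2Λ`.  Proof: `Λ := sup {𝒢(−s;x₀)[v(s)]}` is finite (`abs_gaussAngMom_neg_le`) and positive (O2
  `gaussianCirculation_holds`); along a maximising sequence `(s_k, x_k)` zoom by `λ_k = √(−s_k)` about `x_k`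
  (`isTypeIAncientMild_zoom`; `𝒢` is zoom-invariant, `gaussAngMom_zoom`); an F3-limit (`exists_tendsto_of_isTypeIAncientMild_seq`)
  is a class member, closed-hemisphere (gradients converge), with `𝒢(1;0)[W(−1)] = Λ` and `𝒢 ≤ Λ` everywhere (DCT continuity
  `tendsto_gaussAngMom`); Fermat's theorem on the characteristic `σ ↦ 𝒢(−σ;0)[W(σ)]` with the swirl law `gaussianSwirlLaw_holds`
  gives `−Λ − ℐ/2 = 0`.
* `gaussExtremal_budget` — at such a point `Λ = −ℐ/2 ≤ (4π)^{3/2}·6·C²` (inflow bound `abs_gaussInflow_le`): the maximal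
  scale-invariant Gaussian angular momentum of an enemy is at most `6(4π)^{3/2}C²`.
* `hemisphereLiouvilleE3_of_noGaussExtremal`, `circulationCarryingRigidity_of_noGaussExtremal` — **REDUCTION**: W6 (and the crux,
  via the landed plumbing `circulationCarryingRigidity_of_hemisphereLiouvilleE3`) follows from «no closed-hemisphere door-class
  profile is Gaussian-extremal with maximal inflow `ℐ = −2𝒢`».

Census meaning.  WLOG the enemy of W6 sits at a space–time–scale point where (i) its heat-smoothed vertical vorticity
`(−τ)(e^{(−τ)Δ}ω₃(τ))(y₀)` (`= 𝒢/16π^{3/2}`) is globally maximal over all axes and all times, and (ii) the Gaussian inflow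
correlation takes the extreme value `−2Λ` — «collapse is paid for by inflow» (R⁺) becomes an EQUALITY at the extremal point.  A
kinematic or dynamic inequality `ℐ(1;0)[u] > −2𝒢(1;0)[u]` for closed-hemisphere slices at a `𝒢`-maximal axis would settle W6; the
elementary Burgers-type kinematics (radial inflow `−αr`, axial outflow `2αz` against a swirl supported at `r > 2`) shows that the
sign alone does not give it.

WHAT THIS IS NOT: not a statement about Navier–Stokes regularity (Clay A); door statements are regularity CRITERIA about
HYPOTHETICAL blow-up profiles (KNSS ancient mild solutions).  No item is closed by this file; 25311 stays OPEN at its research stub.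
-/

noncomputable section

-- the summit and its single sub-problem share the name (CONVENTIONS §1), as in every Theorems file
set_option linter.dupNamespace false

namespace Summit.NavierStokesRegularity.NavierStokesRegularity.Theorems.HalfSpaceWindowDoorCirculationCarryingRigidityGaussExtremal

open MeasureTheory Set Function Filter Topology
open scoped RealInnerProductSpace InnerProductSpace
open Literature.Analysis Literature.Analysis.FluidPDE
open Summit.NavierStokesRegularity.NavierStokesRegularity.Theses.HalfSpaceWindowDoor
open Summit.NavierStokesRegularity.NavierStokesRegularity.Theorems.HalfSpaceWindowDoorCirculationCarryingRigidityDefs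
open Summit.NavierStokesRegularity.NavierStokesRegularity.Theorems.HalfSpaceWindowDoorCirculationCarryingRigidityReduction
  (circulationCarryingRigidity_of_hemisphereLiouvilleE3)
open Summit.NavierStokesRegularity.NavierStokesRegularity.Theorems.HalfSpaceWindowDoorCirculationCarryingRigidityGaussBlowdown
  (abs_gaussAngMom_neg_le gaussAngMom_zoom tendsto_gaussAngMom)
open Summit.NavierStokesRegularity.NavierStokesRegularity.Theorems.HalfSpaceWindowDoorCirculationCarryingRigidityGaussCirculation
  (gaussianCirculation_holds)
open Summit.NavierStokesRegularity.NavierStokesRegularity.Theorems.HalfSpaceWindowDoorCirculationCarryingRigidityGaussSwirlLaw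
  (gaussianSwirlLaw_holds)
open Summit.NavierStokesRegularity.NavierStokesRegularity.Theorems.HalfSpaceWindowDoorCirculationCarryingRigidityGaussTilting
  (abs_gaussInflow_le)
open Summit.NavierStokesRegularity.NavierStokesRegularity.Theorems.HalfSpaceWindowDoorCirculationCarryingRigidityHorizontalVorticityFloor
  (tendsto_curl_of_tendsto_fderiv)
open Summit.NavierStokesRegularity.NavierStokesRegularity.Theorems.PoloidalWindowDoorPoloidalWindowRigidityWindow
  (isTypeIAncientMild_of_class)
open Summit.NavierStokesRegularity.NavierStokesRegularity.Theorems
  (exists_tendsto_of_isTypeIAncientMild_seq isTypeIAncientMild_zoom zoom_apply)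

variable {C : ℝ}

/-- A Type-I ancient mild field is a door-class profile (`InDoorClass`, the bundled hypotheses of `HemisphereLiouvilleE3`). -/
theorem inDoorClass_of_isTypeIAncientMild {W : ℝ → EuclideanSpace ℝ (Fin 3) → EuclideanSpace ℝ (Fin 3)}
    (hW : IsTypeIAncientMild C W) : InDoorClass C W :=
  ⟨hW.hasTypeITimeDecay, hW.continuousOn_uncurry, fun _ _ hst ht x => hW.mild_eq_heatExtension hst ht x,
    fun _ ht => hW.isDivFree ht⟩

/-- **Fermat + swirl law.**  If, for a door-class profile `W`, the scale-invariant Gaussian angular momentum along the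
characteristic through the apex `(0, 0)`, `σ ↦ 𝒢(−σ; 0)[W(σ)]`, has a local maximum at `σ = −1`, then the inflow correlation
there is `ℐ(1; 0)[W(−1)] = −2·𝒢(1; 0)[W(−1)]`. -/
theorem gaussInflow_eq_of_isLocalMax {W : ℝ → EuclideanSpace ℝ (Fin 3) → EuclideanSpace ℝ (Fin 3)} (hW : InDoorClass C W)
    (hmax : IsLocalMax (fun σ : ℝ => gaussAngMom (-σ) 0 (W σ)) (-1)) :
    gaussInflow 1 0 (W (-1)) = -2 * gaussAngMom 1 0 (W (-1)) := by
  have hlaw := gaussianSwirlLaw_holds C W hW 0 0 (-1) (by norm_num) (by norm_num)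
  have hfun : (fun σ : ℝ => gaussAngMom (0 - σ) 0 (W σ)) = fun σ => gaussAngMom (-σ) 0 (W σ) := by
    funext σ; rw [zero_sub]
  rw [hfun] at hlaw
  have h0 := hmax.hasDerivAt_eq_zero hlaw
  norm_num at h0
  linarith

/-- **GAUSSIAN-EXTREMAL NORMAL FORM of the enemy of W6.**  If some closed-hemisphere door-class profile (Type-I constant `C`)
has `⟪curl v(s₁)(y₁), e₃⟫ > 0` somewhere, then there is a closed-hemisphere door-class profile `W` (same `C`) whose
scale-invariant Gaussian angular momentum `𝒢(−τ; y₀)[W(τ)]` attains its supremum over all `τ < 0`, `y₀` at `(−1, 0)`, with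
value `Λ = 𝒢(1;0)[W(−1)] > 0`, and whose inflow correlation there is `ℐ(1;0)[W(−1)] = −2Λ`. -/
theorem exists_gaussExtremal {v : ℝ → EuclideanSpace ℝ (Fin 3) → EuclideanSpace ℝ (Fin 3)} (hv : InDoorClass C v)
    (hsign : SignE3 v) (hpos : ∃ s < 0, ∃ y, 0 < ⟪curl (v s) y, e3⟫) :
    ∃ W : ℝ → EuclideanSpace ℝ (Fin 3) → EuclideanSpace ℝ (Fin 3), InDoorClass C W ∧ SignE3 W ∧
      0 < gaussAngMom 1 0 (W (-1)) ∧
      (∀ τ < 0, ∀ y₀, gaussAngMom (-τ) y₀ (W τ) ≤ gaussAngMom 1 0 (W (-1))) ∧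
      gaussInflow 1 0 (W (-1)) = -2 * gaussAngMom 1 0 (W (-1)) := by
  obtain ⟨hrate, hcont, hmild, hdiv⟩ := hv
  have hA : IsTypeIAncientMild C v := isTypeIAncientMild_of_class hrate hcont hmild hdiv
  -- the set of scale-invariant Gaussian angular momenta (apex 0)
  set S : Set ℝ := {m | ∃ s : ℝ, s < 0 ∧ ∃ x₀ : EuclideanSpace ℝ (Fin 3), m = gaussAngMom (-s) x₀ (v s)} with hS
  have hSbdd : BddAbove S := by
    refine ⟨(4 * Real.pi) ^ ((3 : ℝ) / 2) * 2 * (2 * (2 : ℝ) ^ ((3 : ℝ) / 2)) * C, ?_⟩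
    rintro m ⟨s, hs, x₀, rfl⟩
    exact (le_abs_self _).trans (abs_gaussAngMom_neg_le hrate hs x₀)
  obtain ⟨s₁, hs₁, y₁, hy₁⟩ := hpos
  have hmem₁ : gaussAngMom (-s₁) y₁ (v s₁) ∈ S := ⟨s₁, hs₁, y₁, rfl⟩
  have hSne : S.Nonempty := ⟨_, hmem₁⟩
  set Λ : ℝ := sSup S with hΛ
  -- `Λ > 0`
  have hpos₁ : 0 < gaussAngMom (-s₁) y₁ (v s₁) := by
    obtain ⟨hnn, hzero⟩ := gaussianCirculation_holds C v ⟨hrate, hcont, hmild, hdiv⟩ hsign y₁ (-s₁) s₁ (neg_pos.2 hs₁) hs₁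
    rcases hnn.lt_or_eq with h | h
    · exact h
    · exact absurd (hzero h.symm y₁) hy₁.ne'
  have hΛpos : 0 < Λ := lt_of_lt_of_le hpos₁ (le_csSup hSbdd hmem₁)
  have hleΛ : ∀ s < 0, ∀ x₀, gaussAngMom (-s) x₀ (v s) ≤ Λ := fun s hs x₀ => le_csSup hSbdd ⟨s, hs, x₀, rfl⟩
  -- a maximising sequence
  obtain ⟨m, -, hmlim, hmS⟩ := exists_seq_tendsto_sSup hSne hSbdd
  have hch : ∀ n, ∃ sx : ℝ × EuclideanSpace ℝ (Fin 3), sx.1 < 0 ∧ m n = gaussAngMom (-sx.1) sx.2 (v sx.1) := by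
    intro n
    obtain ⟨s, hs, x₀, h⟩ := hmS n
    exact ⟨(s, x₀), hs, h⟩
  choose sx hsx hmsx using hch
  set sn : ℕ → ℝ := fun n => (sx n).1 with hsn
  set xn : ℕ → EuclideanSpace ℝ (Fin 3) := fun n => (sx n).2 with hxn
  have hsn_neg : ∀ n, sn n < 0 := fun n => hsx n
  -- the zooms
  set lam : ℕ → ℝ := fun n => Real.sqrt (-(sn n)) with hlam
  have hlam0 : ∀ n, 0 < lam n := fun n => Real.sqrt_pos.2 (neg_pos.2 (hsn_neg n))
  have hlam2 : ∀ n, lam n ^ 2 = -(sn n) := fun n => Real.sq_sqrt (neg_nonneg.2 (hsn_neg n).le)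
  set w : ℕ → ℝ → EuclideanSpace ℝ (Fin 3) → EuclideanSpace ℝ (Fin 3) :=
    fun n => lam n • stPull (lam n ^ 2) (lam n) 0 (xn n) v with hw
  have hwcl : ∀ n, IsTypeIAncientMild C (w n) := fun n => isTypeIAncientMild_zoom hA (hlam0 n) (xn n)
  have hw_fun : ∀ n τ, w n τ = fun z => lam n • v (lam n ^ 2 * τ) (xn n + lam n • z) := fun n τ =>
    funext fun z => zoom_apply (lam n) (xn n) v τ z
  -- zoom invariance of `𝒢` on the characteristic family
  have hwG : ∀ n, ∀ τ < 0, ∀ y₀, gaussAngMom (-τ) y₀ (w n τ) =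
      gaussAngMom (-(lam n ^ 2 * τ)) (xn n + lam n • y₀) (v (lam n ^ 2 * τ)) := by
    intro n τ hτ y₀
    rw [hw_fun, gaussAngMom_zoom (hlam0 n) (neg_pos.2 hτ) (xn n) y₀ (v (lam n ^ 2 * τ))]
    congr 1
    ring
  have hwGle : ∀ n, ∀ τ < 0, ∀ y₀, gaussAngMom (-τ) y₀ (w n τ) ≤ Λ := by
    intro n τ hτ y₀
    rw [hwG n τ hτ y₀]
    exact hleΛ _ (mul_neg_of_pos_of_neg (pow_pos (hlam0 n) 2) hτ) _
  have hwG1 : ∀ n, gaussAngMom 1 0 (w n (-1)) = m n := by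
    intro n
    have h := hwG n (-1) (by norm_num) 0
    rw [neg_neg] at h
    rw [h, hmsx n, smul_zero, add_zero]
    congr 1
    · rw [hlam2]; ring
    · rw [mul_neg_one, hlam2, neg_neg]
  -- compactness
  obtain ⟨φ, hφ, W, hW, hpt, hptG, -, -⟩ := exists_tendsto_of_isTypeIAncientMild_seq C hwcl
  have hWdoor : InDoorClass C W := inDoorClass_of_isTypeIAncientMild hW
  -- `𝒢` passes to the limit
  have hGlim : ∀ τ < 0, ∀ y₀, Tendsto (fun j => gaussAngMom (-τ) y₀ (w (φ j) τ)) atTop (𝓝 (gaussAngMom (-τ) y₀ (W τ))) := by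
    intro τ hτ y₀
    refine tendsto_gaussAngMom (B := C / Real.sqrt (-τ)) (neg_pos.2 hτ) (fun j => (hwcl (φ j)).continuous_slice hτ)
      (fun j x => (hwcl (φ j)).norm_le hτ x) (fun x => hpt τ hτ x) y₀
  have hG1 : gaussAngMom 1 0 (W (-1)) = Λ := by
    have h1 : Tendsto (fun j => gaussAngMom 1 0 (w (φ j) (-1))) atTop (𝓝 (gaussAngMom 1 0 (W (-1)))) := by
      have h := hGlim (-1) (by norm_num) 0
      rwa [neg_neg] at h
    have h2 : Tendsto (fun j => gaussAngMom 1 0 (w (φ j) (-1))) atTop (𝓝 Λ) := by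
      have h := hmlim.comp hφ.tendsto_atTop
      refine h.congr fun j => ?_
      simp only [Function.comp_apply, hwG1]
    exact tendsto_nhds_unique h1 h2
  have hGle : ∀ τ < 0, ∀ y₀, gaussAngMom (-τ) y₀ (W τ) ≤ Λ := fun τ hτ y₀ =>
    le_of_tendsto' (hGlim τ hτ y₀) fun j => hwGle (φ j) τ hτ y₀
  -- the sign passes to the limit
  have hWsign : SignE3 W := by
    intro τ hτ y
    have hc : Tendsto (fun j => ⟪curl (w (φ j) τ) y, e3⟫) atTop (𝓝 ⟪curl (W τ) y, e3⟫) :=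
      (tendsto_curl_of_tendsto_fderiv (hptG τ hτ y)).inner tendsto_const_nhds
    refine ge_of_tendsto' hc fun j => ?_
    have hcurl : curl (w (φ j) τ) y =
        (lam (φ j) * lam (φ j)) • curl (v (0 + lam (φ j) ^ 2 * τ)) (xn (φ j) + lam (φ j) • y) :=
      curl_smul_stPull (lam (φ j)) (lam (φ j) ^ 2) (lam (φ j)) 0 (xn (φ j)) v τ y
    rw [hcurl, real_inner_smul_left]
    refine mul_nonneg (mul_self_nonneg _) (hsign _ ?_ _)
    rw [zero_add]
    exact mul_neg_of_pos_of_neg (pow_pos (hlam0 _) 2) hτ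
  -- Fermat on the characteristic through the apex
  have hmax : IsLocalMax (fun σ : ℝ => gaussAngMom (-σ) 0 (W σ)) (-1) := by
    filter_upwards [Iio_mem_nhds (show (-1 : ℝ) < 0 by norm_num)] with σ hσ
    rw [neg_neg, hG1]
    exact hGle σ hσ 0
  have hI := gaussInflow_eq_of_isLocalMax hWdoor hmax
  refine ⟨W, hWdoor, hWsign, ?_, ?_, hI⟩
  · rw [hG1]; exact hΛpos
  · intro τ hτ y₀
    rw [hG1]
    exact hGle τ hτ y₀

/-- **EXTREMAL BUDGET.**  At a Gaussian-extremal point the maximal inflow identity `ℐ = −2Λ` and the sign-free inflow bound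
`|ℐ(t;x₀)[v(s)]| ≤ (4π)^{3/2}·12C²·t/(−s)` give `Λ ≤ (4π)^{3/2}·6·C²`. -/
theorem gaussExtremal_budget {W : ℝ → EuclideanSpace ℝ (Fin 3) → EuclideanSpace ℝ (Fin 3)} (hW : InDoorClass C W)
    (hI : gaussInflow 1 0 (W (-1)) = -2 * gaussAngMom 1 0 (W (-1))) :
    gaussAngMom 1 0 (W (-1)) ≤ (4 * Real.pi) ^ ((3 : ℝ) / 2) * (6 * C ^ 2) := by
  have h := abs_gaussInflow_le hW 0 (t := 1) (s := -1) one_pos (by norm_num)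
  rw [hI] at h
  have h' := (neg_le_abs _).trans h
  norm_num at h'
  nlinarith [h', Real.rpow_nonneg (show (0 : ℝ) ≤ 4 * Real.pi by positivity) ((3 : ℝ) / 2)]

/-- **REDUCTION: W6 from «no Gaussian-extremal closed-hemisphere profile».**  If no closed-hemisphere door-class profile `W`
has positive, globally maximal scale-invariant Gaussian angular momentum at `(−1, 0)` together with the maximal-inflow identity
`ℐ(1;0)[W(−1)] = −2𝒢(1;0)[W(−1)]`, then `HemisphereLiouvilleE3` holds. -/
theorem hemisphereLiouvilleE3_of_noGaussExtremal
    (h : ∀ (C : ℝ) (W : ℝ → EuclideanSpace ℝ (Fin 3) → EuclideanSpace ℝ (Fin 3)), InDoorClass C W → SignE3 W →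
      0 < gaussAngMom 1 0 (W (-1)) →
      (∀ τ < 0, ∀ y₀, gaussAngMom (-τ) y₀ (W τ) ≤ gaussAngMom 1 0 (W (-1))) →
      gaussInflow 1 0 (W (-1)) = -2 * gaussAngMom 1 0 (W (-1)) → False) :
    HemisphereLiouvilleE3 := by
  intro C v hrate hcont hmild hdiv hsign s hs y
  by_contra hne
  have hpos : 0 < ⟪curl (v s) y, e3⟫ := lt_of_le_of_ne (hsign s hs y) (Ne.symm hne)
  obtain ⟨W, hW, hWs, hΛ, hmax, hI⟩ :=
    exists_gaussExtremal (C := C) ⟨hrate, hcont, hmild, hdiv⟩ hsign ⟨s, hs, y, hpos⟩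
  exact h C W hW hWs hΛ hmax hI

/-- **The crux from «no Gaussian-extremal closed-hemisphere profile»** (composition with the landed plumbing stub
`stub_rotate` through `circulationCarryingRigidity_of_hemisphereLiouvilleE3`). -/
theorem circulationCarryingRigidity_of_noGaussExtremal
    (h : ∀ (C : ℝ) (W : ℝ → EuclideanSpace ℝ (Fin 3) → EuclideanSpace ℝ (Fin 3)), InDoorClass C W → SignE3 W →
      0 < gaussAngMom 1 0 (W (-1)) →
      (∀ τ < 0, ∀ y₀, gaussAngMom (-τ) y₀ (W τ) ≤ gaussAngMom 1 0 (W (-1))) →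
      gaussInflow 1 0 (W (-1)) = -2 * gaussAngMom 1 0 (W (-1)) → False) :
    CirculationCarryingRigidity :=
  circulationCarryingRigidity_of_hemisphereLiouvilleE3 (hemisphereLiouvilleE3_of_noGaussExtremal h)

end Summit.NavierStokesRegularity.NavierStokesRegularity.Theorems.HalfSpaceWindowDoorCirculationCarryingRigidityGaussExtremal

end
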